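import Summits.Parity.GeneralizedHardyLittlewood.Theorems.GreenTaoLevelTwoGITwoCyclicInversePhaseReplacedFamily

/-!
# Route `GreenTaoLevelTwo`, crux `GITwo` (stmt-Parity-21275), line `birth`, stub `stub_cyclicInverse`:
# C13 assembly, step 6a: the §9 kernel factorises, its weights are bounded, and the final rewriting

Eighty-fifth helper file toward the XL stub `stub_cyclicInverse` (B. Green, T. Tao, *An inverse
theorem for the Gowers `U³(G)` norm*, arXiv:math/0503014, Thm. 68 = PEMS 51 (2008) Thm. 12.8).
Block C13 (§9 Step 4 bookkeeping): the kernel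
`G y h x = b₂(x+y+h+h') conj e(cμ(x+h)(x+h)) · (b₃(x+y) e(−μ(h')(x+y))) e(cμ(x)x)` produced by
`exists_phase_replaced_family` is `1`-bounded and factorises through `x = x₀ + w` as
`Φ x₀ y w · Ψ x₀ y (w+h)` (the hypotheses `hG`, `hΨ`, `hfac` of `exists_localised_linear_correlation`),
and the resulting local correlation `Σ_{w∈B₅} Φ x₀ y w e(wξ)` is, up to a unimodular constant, the
paper's `Σ_{w∈B₅} f(w+t) e(M(w+x₀)(w+x₀)) e(wζ)` with `t = x₀ + y`, `ζ = ξ − ξ₀ − μ(h')` when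
`b₃ = f · e(−·ξ₀)`.  Def-free:

* `norm_kernel_le_one`, `norm_kernelWeight_le_one`, `kernel_factorises`;
* `norm_local_sum_eq` — the final rewriting (norms agree).

References: [GreenTao2008U3Inverse] arXiv:math/0503014, §9 Step 4.
-/

noncomputable section

namespace Summit.Parity.GeneralizedHardyLittlewood.GreenTaoLevelTwoGITwoCyclicInverse

open Finset ZMod
open scoped ComplexConjugate
open Literature.NumberTheory.Sieve

variable {N : ℕ} [NeZero N]

/-- The weight `b(y,h) e(cμ(h)h)` is `1`-bounded. [folklore] -/
theorem norm_kernelWeight_le_one (b : ZMod N → ZMod N → ℂ) (hb : ∀ y h, ‖b y h‖ ≤ 1) (c : ZMod N)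
    (μ : ZMod N → ZMod N) (y h : ZMod N) :
    ‖b y h * stdAddChar (c * μ h * h)‖ ≤ 1 := by
  rw [norm_mul, norm_stdAddChar, mul_one]; exact hb y h

/-- The §9 kernel is `1`-bounded. [folklore] -/
theorem norm_kernel_le_one (b₂ b₃ : ZMod N → ℂ) (hb₂ : ∀ x, ‖b₂ x‖ ≤ 1) (hb₃ : ∀ x, ‖b₃ x‖ ≤ 1)
    (c h' : ZMod N) (μ : ZMod N → ZMod N) (y h x : ZMod N) :
    ‖(b₂ (x + y + h + h') * conj (ZMod.stdAddChar (c * μ (x + h) * (x + h)) : ℂ)) *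
        ((b₃ (x + y) * stdAddChar (-(μ h' * (x + y)))) * stdAddChar (c * μ x * x))‖ ≤ 1 := by
  rw [norm_mul, norm_mul, norm_mul, norm_mul, Complex.norm_conj, norm_stdAddChar, norm_stdAddChar,
    norm_stdAddChar, mul_one, mul_one, mul_one]
  calc ‖b₂ (x + y + h + h')‖ * ‖b₃ (x + y)‖ ≤ 1 * 1 :=
        mul_le_mul (hb₂ _) (hb₃ _) (norm_nonneg _) zero_le_one
    _ = 1 := one_mul 1

/-- The second factor `Ψ x₀ y v = b₂(x₀+v+y+h') conj e(cμ(x₀+v)(x₀+v))` is `1`-bounded. [folklore] -/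
theorem norm_kernelPsi_le_one (b₂ : ZMod N → ℂ) (hb₂ : ∀ x, ‖b₂ x‖ ≤ 1) (c h' : ZMod N)
    (μ : ZMod N → ZMod N) (x₀ y v : ZMod N) :
    ‖b₂ (x₀ + v + y + h') * conj (ZMod.stdAddChar (c * μ (x₀ + v) * (x₀ + v)) : ℂ)‖ ≤ 1 := by
  rw [norm_mul, Complex.norm_conj, norm_stdAddChar, mul_one]; exact hb₂ _

/-- **The kernel factorises** through `x = x₀ + w`:
`G y h (x₀+w) = Φ x₀ y w · Ψ x₀ y (w+h)` with
`Φ x₀ y w = (b₃(x₀+w+y) e(−μ(h')(x₀+w+y))) e(cμ(x₀+w)(x₀+w))` and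
`Ψ x₀ y v = b₂(x₀+v+y+h') conj e(cμ(x₀+v)(x₀+v))`. [cite: GreenTao2008U3Inverse, §9 Step 4] -/
theorem kernel_factorises (b₂ b₃ : ZMod N → ℂ) (c h' : ZMod N) (μ : ZMod N → ZMod N)
    (x₀ y h w : ZMod N) :
    (b₂ ((x₀ + w) + y + h + h') * conj (ZMod.stdAddChar (c * μ ((x₀ + w) + h) * ((x₀ + w) + h)) : ℂ)) *
        ((b₃ ((x₀ + w) + y) * stdAddChar (-(μ h' * ((x₀ + w) + y)))) *
          stdAddChar (c * μ (x₀ + w) * (x₀ + w))) =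
      ((b₃ (x₀ + w + y) * stdAddChar (-(μ h' * (x₀ + w + y)))) *
          stdAddChar (c * μ (x₀ + w) * (x₀ + w))) *
        (b₂ (x₀ + (w + h) + y + h') *
          conj (ZMod.stdAddChar (c * μ (x₀ + (w + h)) * (x₀ + (w + h))) : ℂ)) := by
  have e1 : x₀ + w + y + h + h' = x₀ + (w + h) + y + h' := by ring
  have e2 : x₀ + w + h = x₀ + (w + h) := by ring
  rw [e1, e2]
  ring

/-- **The final rewriting**: with `b₃ = f · e(−·ξ₀)`,
`‖Σ_{w∈B₅} Φ x₀ y w e(wξ)‖ = ‖Σ_{w∈B₅} f(w + (x₀+y)) e(cμ(x₀+w)(x₀+w)) e(w(ξ − ξ₀ − μ h'))‖`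
(the unimodular constant `e(−(x₀+y)(ξ₀ + μ h'))` is pulled out).
[cite: GreenTao2008U3Inverse, §9 Step 4 ("The u³ norm being invariant under … modulation")] -/
theorem norm_local_sum_eq (B₅ : Finset (ZMod N)) (f : ZMod N → ℝ) (c h' ξ₀ ξ : ZMod N)
    (μ : ZMod N → ZMod N) (x₀ y : ZMod N) :
    ‖∑ w ∈ B₅, ((((f (x₀ + w + y) : ℝ) : ℂ) * stdAddChar (-((x₀ + w + y) * ξ₀))) *
        stdAddChar (-(μ h' * (x₀ + w + y)))) * stdAddChar (c * μ (x₀ + w) * (x₀ + w)) *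
        stdAddChar (w * ξ)‖ =
      ‖∑ w ∈ B₅, ((f (w + (x₀ + y)) : ℝ) : ℂ) * stdAddChar (c * μ (x₀ + w) * (x₀ + w)) *
        stdAddChar (w * (ξ - ξ₀ - μ h'))‖ := by
  -- pull out the constant `u = e(−(x₀+y)ξ₀) e(−μ h' (x₀+y))`
  set u : ℂ := (stdAddChar (-((x₀ + y) * ξ₀)) : ℂ) * stdAddChar (-(μ h' * (x₀ + y))) with hu
  have hu1 : ‖u‖ = 1 := by rw [hu, norm_mul, norm_stdAddChar, norm_stdAddChar, mul_one]
  have hterm : ∀ w : ZMod N,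
      ((((f (x₀ + w + y) : ℝ) : ℂ) * stdAddChar (-((x₀ + w + y) * ξ₀))) *
        stdAddChar (-(μ h' * (x₀ + w + y)))) * stdAddChar (c * μ (x₀ + w) * (x₀ + w)) *
        stdAddChar (w * ξ) =
      u * (((f (w + (x₀ + y)) : ℝ) : ℂ) * stdAddChar (c * μ (x₀ + w) * (x₀ + w)) *
        stdAddChar (w * (ξ - ξ₀ - μ h'))) := by
    intro w
    have e1 : x₀ + w + y = w + (x₀ + y) := by ring
    -- collect all characters into one
    have key : (stdAddChar (-((x₀ + w + y) * ξ₀)) : ℂ) * stdAddChar (-(μ h' * (x₀ + w + y))) *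
        stdAddChar (w * ξ) = u * stdAddChar (w * (ξ - ξ₀ - μ h')) := by
      rw [hu, ← AddChar.map_add_eq_mul, ← AddChar.map_add_eq_mul, ← AddChar.map_add_eq_mul,
        ← AddChar.map_add_eq_mul]
      congr 1; ring
    calc _ = ((f (x₀ + w + y) : ℝ) : ℂ) * stdAddChar (c * μ (x₀ + w) * (x₀ + w)) *
          ((stdAddChar (-((x₀ + w + y) * ξ₀)) : ℂ) * stdAddChar (-(μ h' * (x₀ + w + y))) *
            stdAddChar (w * ξ)) := by ring
      _ = _ := by rw [key, e1]; ring
  rw [Finset.sum_congr rfl fun w _ => hterm w, ← Finset.mul_sum, norm_mul, hu1, one_mul]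

end Summit.Parity.GeneralizedHardyLittlewood.GreenTaoLevelTwoGITwoCyclicInverse
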